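import Summits.ResolutionOfSingularities.ResolutionOfSingularities.Theorems.FrobeniusLadderFRationalResolutionToricRetract
import Summits.ResolutionOfSingularities.ResolutionOfSingularities.Theorems.FrobeniusLadderFRationalResolutionRetractLocalization
import Summits.ResolutionOfSingularities.ResolutionOfSingularities.Theorems.FrobeniusLadderFRationalResolutionRegularRingLocalization
import Summits.ResolutionOfSingularities.ResolutionOfSingularities.Theorems.FrobeniusLadderFRationalResolutionClauseOfRetractRegular
import Summits.ResolutionOfSingularities.ResolutionOfSingularities.Theorems.FrobeniusLadderFRationalResolutionToricBaseRegular
import Summits.ResolutionOfSingularities.ResolutionOfSingularities.Theorems.FrobeniusLadderFRationalResolutionToricLocallyOfFiniteType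
import Summits.ResolutionOfSingularities.ResolutionOfSingularities.Theorems.FrobeniusLadderFRationalResolutionWeaklyFRegularModelLocal
import Mathlib.AlgebraicGeometry.Morphisms.Separated
import Mathlib.Algebra.CharP.Algebra
import HarnessLib

/-!
# Toric surface programme: every affine toric surface lies in the residual class of the crux

Support file for crux stmt-ResolutionOfSingularities-15317 (`FrobeniusLadder.FRationalResolution`), line `redirect`,
lead c4. For every prime `p`, every field `k` of characteristic `p` and all `a ≤ r`, `1 ≤ r`, the affine toric surface
`U(r,a) = Spec TA[r,a]`, `TA[r,a] = k[{m ∈ ℤ² : 0 ≤ m₂, a m₂ ≤ r m₁}]` (every cyclic quotient surface singularity, every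
field) satisfies ALL hypotheses of rung 4′ (`WeaklyFRegularResolution`, the redirect line's piece X₂) and a fortiori
the F-rational hypothesis of the crux itself:

* `toric_localization_clause` — every local ring `TA[r,a]_P` is a domain in which EVERY ideal is tightly closed
  (inline clause): `TA[r,a]` is a direct summand of the polynomial ring `TA[1,0] = k[ℕ²]` (`stub_toric_retract`,
  the Reynolds operator written on exponents — valid also in the wild case `p ∣ r`), direct summands localize
  (`stub_retract_localization`), localizations of the regular ring `k[ℕ²]` are regular domains
  (`stub_toric_base_isRegularRing`, `stub_isRegularRing_localization`), and direct summands of regular domains have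
  every ideal tightly closed (`stub_clause_of_retract_regular` = Hochster–Huneke 1990 Prop. 4.12 over c1's lemmas);
* `toricSurface_stalk_clause` — the same for the stalks of `U(r,a)` (`Spec.stalkIso`);
* `toricSurface_residualClass` — `U(r,a) → Spec k` is separated, locally of finite type (Gordan, `stub_toric_finiteType`),
  quasi-compact, `U(r,a)` is integral, and every stalk is a domain with every ideal tightly closed;
* `toricSurface_fRationalHypothesis` — in particular the crux's F-rational stalk clause holds on `U(r,a)`.

With `hasResolution_toricSurface` (…ToricResolution.lean): rung 4′ is a THEOREM on this two-parameter family of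
members of the residual class — the first members in the tree that are not hypersurfaces (for `a ≠ r − 1` the
singularity `1/r(1,a)` is not Gorenstein). All folklore (Hochster 1972; Bruns–Herzog 6.1; Hochster–Huneke 1990
Prop. 4.12); no published fact is used as a hypothesis.
-/

-- single-problem summit: the doubled namespace component is forced
set_option linter.dupNamespace false

noncomputable section

namespace Summit.ResolutionOfSingularities.ResolutionOfSingularities.Theorems.FRationalResolution

open CategoryTheory AlgebraicGeometry TopologicalSpace
open Literature.AlgebraicGeometry.Resolution

section Toric

variable (k : Type) [Field k]

/-- The Laurent polynomial ring `k[ℤ²]` (coordinate ring of the 2-torus). -/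
local notation3 "Lk" => AddMonoidAlgebra k (ℤ × ℤ)

/-- The lattice points of the dual cone `σ∨ = {m₂ ≥ 0, a m₂ ≤ r m₁}` of `σ = cone((0,1),(r,-a))`. -/
local notation3 "σS[" r ", " a "]" =>
  {m : ℤ × ℤ | 0 ≤ m.2 ∧ ((a : ℕ) : ℤ) * m.2 ≤ ((r : ℕ) : ℤ) * m.1}

/-- The toric surface algebra `k[σ∨ ∩ ℤ²] ⊆ k[ℤ²]`. -/
local notation3 "TA[" r ", " a "]" =>
  Algebra.adjoin k ((fun m : ℤ × ℤ => AddMonoidAlgebra.single m (1 : k)) '' σS[r, a])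

/-- **Every local ring of the toric surface algebra is a domain with EVERY ideal tightly closed** (inline
weakly-F-regular clause of rung 4′). Direct summand of `k[ℕ²]` ⇒ localized direct summand of a localization of
`k[ℕ²]`, which is a regular domain of characteristic `p`; conclude with Hochster–Huneke 1990 Prop. 4.12.
[folklore; HochsterHuneke1990 Prop. 4.12, Hochster 1972] -/
theorem toric_localization_clause (p : ℕ) [Fact p.Prime] [CharP k p] (r a : ℕ) (hr : 1 ≤ r)
    (P : Ideal ↥TA[r, a]) [P.IsPrime] :
    IsDomain (Localization.AtPrime P) ∧ ∀ I : Ideal (Localization.AtPrime P),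
      ∀ y c : Localization.AtPrime P, c ≠ 0 →
      (∀ e : ℕ, c * y ^ p ^ e ∈ Ideal.span ((fun z : Localization.AtPrime P => z ^ p ^ e) ''
        (I : Set (Localization.AtPrime P)))) → y ∈ I := by
  obtain ⟨Λ, ρ, hΛ, h1, h2⟩ := stub_toric_retract k r a hr
  obtain ⟨Λ', ρ', hΛ', h1', h2', -⟩ := stub_retract_localization Λ ρ hΛ h1 h2 P
  -- the big ring `S_T`, `S = TA[1,0] = k[ℕ²]`, `T = Λ(TA[r,a] ∖ P)`: a regular domain of characteristic `p`
  haveI : IsRegularRing ↥TA[1, 0] := stub_toric_base_isRegularRing k 1 le_rfl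
  haveI : IsDomain ↥TA[1, 0] := inferInstance
  have hT : P.primeCompl.map Λ ≤ nonZeroDivisors ↥TA[1, 0] := by
    rintro _ ⟨u, hu, rfl⟩
    refine mem_nonZeroDivisors_of_ne_zero fun h0 => hu ?_
    have hu0 : u = 0 := hΛ (by rw [h0, map_zero])
    rw [hu0]; exact P.zero_mem
  haveI : IsDomain (Localization (P.primeCompl.map Λ)) := IsLocalization.isDomain_localization hT
  haveI : IsRegularRing (Localization (P.primeCompl.map Λ)) := stub_isRegularRing_localization _
  haveI : CharP (Localization (P.primeCompl.map Λ)) p := by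
    refine charP_of_injective_ringHom (f := (algebraMap (↥TA[1, 0]) (Localization (P.primeCompl.map Λ))).comp
      (algebraMap k ↥TA[1, 0])) ?_ p
    exact (IsLocalization.injective (Localization (P.primeCompl.map Λ)) hT).comp
      (algebraMap k ↥TA[1, 0]).injective
  exact stub_clause_of_retract_regular p Λ' ρ' hΛ' h1' h2'

/-- **Every stalk of the toric surface `U(r,a) = Spec TA[r,a]` is a domain with every ideal tightly closed**
(`Spec.stalkIso` + transport of the clause along ring isomorphisms). [folklore] -/
theorem toricSurface_stalk_clause (p : ℕ) [Fact p.Prime] [CharP k p] (r a : ℕ) (hr : 1 ≤ r)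
    (z : Spec (CommRingCat.of ↥TA[r, a])) :
    IsDomain ((Spec (CommRingCat.of ↥TA[r, a])).presheaf.stalk z) ∧
      ∀ I : Ideal ((Spec (CommRingCat.of ↥TA[r, a])).presheaf.stalk z),
      ∀ y c : (Spec (CommRingCat.of ↥TA[r, a])).presheaf.stalk z, c ≠ 0 →
      (∀ e : ℕ, c * y ^ p ^ e ∈ Ideal.span ((fun w : (Spec (CommRingCat.of ↥TA[r, a])).presheaf.stalk z =>
        w ^ p ^ e) '' (I : Set ((Spec (CommRingCat.of ↥TA[r, a])).presheaf.stalk z)))) → y ∈ I := by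
  exact domain_allIdeals_clause_of_iso p (Spec.stalkIso (CommRingCat.of ↥TA[r, a]) z)
    (toric_localization_clause k p r a hr z.asIdeal)

/-- **EVERY AFFINE TORIC SURFACE LIES IN THE RESIDUAL CLASS OF THE CRUX** (indeed in the class of rung 4′):
for `1 ≤ r`, `a ≤ r` and every field `k` of characteristic `p`, the structure morphism `U(r,a) → Spec k` is
separated, locally of finite type (Gordan) and quasi-compact, `U(r,a)` is integral, and every stalk is a domain in
which every ideal is tightly closed. [folklore] -/
theorem toricSurface_residualClass (p : ℕ) [Fact p.Prime] [CharP k p] (r a : ℕ) (hr : 1 ≤ r) (har : a ≤ r) :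
    IsSeparated (Spec.map (CommRingCat.ofHom (algebraMap k ↥TA[r, a]))) ∧
      LocallyOfFiniteType (Spec.map (CommRingCat.ofHom (algebraMap k ↥TA[r, a]))) ∧
      QuasiCompact (Spec.map (CommRingCat.ofHom (algebraMap k ↥TA[r, a]))) ∧
      IsIntegral (Spec (CommRingCat.of ↥TA[r, a])) ∧
      ∀ z : Spec (CommRingCat.of ↥TA[r, a]),
        IsDomain ((Spec (CommRingCat.of ↥TA[r, a])).presheaf.stalk z) ∧
        ∀ I : Ideal ((Spec (CommRingCat.of ↥TA[r, a])).presheaf.stalk z),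
        ∀ y c : (Spec (CommRingCat.of ↥TA[r, a])).presheaf.stalk z, c ≠ 0 →
        (∀ e : ℕ, c * y ^ p ^ e ∈ Ideal.span ((fun w : (Spec (CommRingCat.of ↥TA[r, a])).presheaf.stalk z =>
          w ^ p ^ e) '' (I : Set ((Spec (CommRingCat.of ↥TA[r, a])).presheaf.stalk z)))) → y ∈ I := by
  haveI : IsDomain ↥TA[r, a] := inferInstance
  exact ⟨inferInstance, stub_toric_locallyOfFiniteType k r a hr har, inferInstance, inferInstance,
    fun z => toricSurface_stalk_clause k p r a hr z⟩

/-- **The crux's F-rational hypothesis holds on every affine toric surface**: every stalk of `U(r,a)` is a domain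
whose parameter ideals (indeed all ideals) are tightly closed in the inline sense of `FRationalResolution`.
[folklore] -/
theorem toricSurface_fRationalHypothesis (p : ℕ) [Fact p.Prime] [CharP k p] (r a : ℕ) (hr : 1 ≤ r)
    (z : Spec (CommRingCat.of ↥TA[r, a])) :
    IsDomain ((Spec (CommRingCat.of ↥TA[r, a])).presheaf.stalk z) ∧
      ∀ d : ℕ, ringKrullDim ((Spec (CommRingCat.of ↥TA[r, a])).presheaf.stalk z) = d →
      ∀ s : Fin d → (Spec (CommRingCat.of ↥TA[r, a])).presheaf.stalk z,
        (Ideal.span (Set.range s)).radical.IsMaximal →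
      ∀ y c : (Spec (CommRingCat.of ↥TA[r, a])).presheaf.stalk z, c ≠ 0 →
      (∀ e : ℕ, c * y ^ p ^ e ∈ Ideal.span ((fun w : (Spec (CommRingCat.of ↥TA[r, a])).presheaf.stalk z =>
        w ^ p ^ e) '' (Ideal.span (Set.range s) : Set ((Spec (CommRingCat.of ↥TA[r, a])).presheaf.stalk z)))) →
      y ∈ Ideal.span (Set.range s) := by
  obtain ⟨hdom, hcl⟩ := toricSurface_stalk_clause k p r a hr z
  exact ⟨hdom, fun _ _ s _ y c hc hmem => hcl _ y c hc hmem⟩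

end Toric

end Summit.ResolutionOfSingularities.ResolutionOfSingularities.Theorems.FRationalResolution

end
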